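import Literature.AlgebraicGeometry.AbelianSchemes.WeilUnitMulRight
import Literature.AlgebraicGeometry.AbelianSchemes.TorsionSectionPointDatum
import Literature.AlgebraicGeometry.AbelianSchemes.AbelianSchemeOverHomOfReduced
import HarnessLib

/-!
# The Weil character `χ(ŷ, x) = e_n(x, ŷ) ∈ T` of finite torsion points, and its four laws
# ([Mumford AV] §20 pp. 183–185: «`e_n` is a pairing, compatible with base change»)

Topic `Literature/AlgebraicGeometry/AbelianSchemes`; namespaces `Literature.AlgebraicGeometry.AbelianSchemes.AbelianSchemeOver` (§1–§2, plumbing: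
points ↔ sections) and `….AbelianSchemeOver.DualPair` (§2 transport, §3 the character).  Plumbing `def`s with bodies (`ptSection`, `ptSectionMulEquiv`,
`ptTorsionSection`, `weilChar`) + theorems; no named fact, no instance, no notation, no `sorry`.  Cell `hodgecm-mathlib` (D-0151), FLOOR 0, P6 «MOD
programme» (crux hLiu418 = stmt-HodgeConjecture-24832), W-line `Cruxes/HLiu418/Lines/F0_P6b_WeilCartierDuality.lean` letter `stub_W1` «WeilPairingNatural»,
σ1 road step **(σ1-f1)** of the assembly (LEAD F0P6-plan (g2) HANDS BOARD 21:52Z; HANDOVER memo `F0/P6/B-p08/g32/HANDOVER-sigma1f-….md`): the CHARACTER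
FAMILY on FINITE test rings that the Cartier-side dock ★ `CartierDualCharacterYonedaHom.exists_hom_cartierDual_of_character_of_finite` (B-p04, (σ1-a)) turns
into the homomorphism `Â[n] → (A[n])^D`, with its four hypotheses `hnat ∕ hmulx ∕ honex ∕ hmuly` DISCHARGED over ★ `weilUnit` ((σ1-b) p846716), ★
`weilUnit_mul_right` ((σ1-c) p846768) and ★ `weilUnit_baseChange`.  HC_CM is proved only modulo the printed citations until rung 0 closes; nothing here is
about HC.

THE PRINT.  [MumfordAV1970] §20 pp. 183–185: `e_n : X_n × X̂_n → μ_n` is a pairing («`e_n(x + y, L) = e_n(x, L) e_n(y, L)`, `e_n(x, L ⊗ M) = e_n(x, L) e_n(x, M)`»),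
compatible with base change; [MilneAV2008] I §11.  Scheme-theoretically, on `T`-points over finite `k`-algebras `T` (all one needs over a field: the
realisations of `A[n]`, `Â[n]` are finite `k`-schemes, [Tate1997FiniteFlatGroupSchemes] §(3.8)).

WHAT IS HERE (`A∕S` an abelian scheme; from §3 on `S = Spec k`, `k` a field, `D = (Â, 𝒫)` a dual pair with the unit hypothesis `hD`):
* §1 `ptSection f c : (A.baseChange f).Sections` — a `T`-point `c : T → A` over `f : T → S` as the section `(c, 1_T)` of `A_T → T` (the inverse of ★
  `sectionToPointHom`: `sectionToPointHom_ptSection`, `ptSection_sectionToPointHom`, `ptSectionMulEquiv`), `ptSection_left_fst ∕ _snd`, `Sections.ext_fst`,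
  `ptSection_mul ∕ _one ∕ _pow_eq_one`, `ptTorsionSection`;
* §2 `sectionAlong_left_fst`, **`sectionAlong_ptSection`** ∕ `torsionSectionAlong_ptTorsionSection` (the section of a point along `t : T′ → T` is the section of
  `t ≫ c`, ★ `sectionAlong` ∕ `pointAlong`), **`ptSection_comp_baseChangeHom`** (`(c, 1) ≫ φ_T = (c ≫ φ, 1)`, ★ `baseChangeHom`), and the transport lemma
  **`DualPair.weilUnit_congr_base`**: along EQUAL base morphisms `f = f′` the Weil units of points∕sections with the same underlying morphisms agree (the
  device by which `Spec θ ≫ Spec(k → T) = Spec(k → T′)`, true only propositionally, is crossed);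
* §3 `isLocallyNoetherian_spec_of_finite`, `isCommMonObj_baseChange_of_field`, **`DualPair.weilChar hD n y hy x hx : T`** for `n`-torsion points
  `y : Spec T → Â`, `x : Spec T → A` over `k` (`T` a finite `k`-algebra; ★ `weilUnit` of `ptTorsionSection x` against `y`, read in `T` through Mathlib
  `Scheme.ΓSpecIso`; junk value `1` over non-finite `T`), `weilChar_eq`, `weilChar_congr`, and the FOUR LAWS **`weilChar_mul_right`** (in `x`, ★ `weilUnit_mul`),
  **`weilChar_one_right`**, **`weilChar_mul_left`** (in `ŷ`, ★ `weilUnit_mul_right`), **`weilChar_naturality`** (`χ(Spec θ ≫ ŷ, Spec θ ≫ x) = θ(χ(ŷ, x))`,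
  ★ `weilUnit_baseChange` + §2 + `Scheme.ΓSpecIso_naturality`).

NOT HERE (sequel (σ1-f2)): the realisations `j : G ↪ A`, `ĵ : Ĝ ↪ Â`, the homomorphism `w : Ĝ → G^D` with `⟪y ≫ w, x⟫ = χ(y ≫ ĵ, x ≫ j)`, its kernel
((σ1-d)) and naturality ((σ1-e)), the isomorphism.

## References
* [MumfordAV1970] D. Mumford, *Abelian Varieties* (1970), §20 (pp. 183–185).
* [MilneAV2008] J. S. Milne, *Abelian Varieties* (2008), I §11 (the `e_m`-pairing), I §8 (pp. 36–37).
* [Tate1997FiniteFlatGroupSchemes] J. Tate, *Finite flat group schemes* (1997), §(3.8) p. 145.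
* [GortzWedhorn2020] U. Görtz, T. Wedhorn, *Algebraic Geometry I*, 2nd ed. (2020), Section (4.7), (4.7.1) (p. 108).
* [MumfordFogartyKirwan1994] D. Mumford, J. Fogarty, F. Kirwan, *GIT*, 3rd ed. (1994), Ch. 7 §2 Def. 7.2 (p. 129).
-/

set_option autoImplicit false

noncomputable section

-- `TopCat.Presheaf`/`Scheme.Modules` are not reducible (as in Mathlib's `AlgebraicGeometry/Modules` and ★ `WeilUnitOfTorsionPoint`).
set_option backward.isDefEq.respectTransparency false

universe u

open CategoryTheory CategoryTheory.Limits AlgebraicGeometry MonoidalCategory CartesianMonoidalCategory TopologicalSpace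
  Opposite
open scoped MonObj

namespace Literature.AlgebraicGeometry.AbelianSchemes.AbelianSchemeOver

open Literature.AlgebraicGeometry.RelativeSpec Literature.AlgebraicGeometry.Modules Literature.AlgebraicGeometry.Motives
  Literature.AlgebraicGeometry.RelativeSpec.ActionOver

/-! ## §1 A `T`-point of `A` over `f` as a section of `A_T` -/

section PtSection

open scoped CategoryTheory.Obj

variable {S : Scheme.{u}} (A : AbelianSchemeOver S) (M : ℕ) {T : Scheme.{u}} (f : T ⟶ S)

/-- **A `T`-point `c : T → A` over `f` as a SECTION of `A_T → T`** (`(c, 1_T) : T → A ×_S T`; the adjunction `Over.map f ⊣ Over.pullback f`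
at `𝟙_T`, Mathlib `Over.mapPullbackAdj`, precomposed with `Over.mk (𝟙 ≫ f) ≅ Over.mk f`); the inverse of ★ `sectionToPointHom`.
[cite: GortzWedhorn2020, Section (4.7), (4.7.1) (p. 108)] -/
def ptSection (c : Over.mk f ⟶ A.X) : (A.baseChange f).Sections :=
  Over.homMk (pullback.lift c.left (𝟙 T) ((Over.w c).trans (Category.id_comp f).symm)) (pullback.lift_snd _ _ _)

/-- Underlying morphism `(c, 1_T) : T → A ×_S T`. [cite: GortzWedhorn2020, Section (4.7), (4.7.1) (p. 108)] -/
theorem ptSection_left (c : Over.mk f ⟶ A.X) :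
    (A.ptSection f c).left = pullback.lift c.left (𝟙 T) ((Over.w c).trans (Category.id_comp f).symm) := rfl

/-- The section of a point, composed with `pr_A`, is the point. [cite: GortzWedhorn2020, Section (4.7), (4.7.1) (p. 108)] -/
@[reassoc (attr := simp)]
theorem ptSection_left_fst (c : Over.mk f ⟶ A.X) : (A.ptSection f c).left ≫ pullback.fst A.X.hom f = c.left := by
  rw [ptSection_left, pullback.lift_fst]

/-- The section of a point is a section: composed with `pr_T` it is `𝟙 T`. [cite: GortzWedhorn2020, Section (4.7), (4.7.1) (p. 108)] -/
@[reassoc (attr := simp)]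
theorem ptSection_left_snd (c : Over.mk f ⟶ A.X) : (A.ptSection f c).left ≫ pullback.snd A.X.hom f = 𝟙 T := by
  rw [ptSection_left, pullback.lift_snd]

/-- `sectionToPointHom ∘ ptSection = id`. [cite: GortzWedhorn2020, Section (4.7), (4.7.1) (p. 108)] -/
@[simp]
theorem sectionToPointHom_ptSection [IsCommMonObj (A.baseChange f).X] (c : Over.mk f ⟶ A.X) :
    A.sectionToPointHom f (A.ptSection f c) = c := by
  ext : 1
  rw [sectionToPointHom_left, ptSection_left_fst]

/-- `ptSection ∘ sectionToPointHom = id`. [cite: GortzWedhorn2020, Section (4.7), (4.7.1) (p. 108)] -/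
@[simp]
theorem ptSection_sectionToPointHom [IsCommMonObj (A.baseChange f).X] (k : (A.baseChange f).Sections) :
    A.ptSection f (A.sectionToPointHom f k) = k := by
  ext : 1
  refine pullback.hom_ext ?_ ?_
  · rw [ptSection_left_fst, sectionToPointHom_left]
  · rw [ptSection_left_snd]
    have h := Over.w k
    exact h.symm

/-- Sections of `A_T` are determined by their composite with `pr_A`. [cite: GortzWedhorn2020, Section (4.7), (4.7.1) (p. 108)] -/
theorem Sections.ext_fst {k k' : (A.baseChange f).Sections}
    (h : k.left ≫ pullback.fst A.X.hom f = k'.left ≫ pullback.fst A.X.hom f) : k = k' := by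
  ext : 1
  refine pullback.hom_ext h ?_
  have h1 := Over.w k
  have h2 := Over.w k'
  exact h1.trans h2.symm

variable [IsCommMonObj (A.baseChange f).X]

/-- `ptSection` is multiplicative (it is the inverse of the group homomorphism ★ `sectionToPointHom`).
[cite: GortzWedhorn2020, Section (4.7), (4.7.1) (p. 108)] -/
theorem ptSection_mul (c c' : Over.mk f ⟶ A.X) : A.ptSection f (c * c') = A.ptSection f c * A.ptSection f c' := by
  have hinj : Function.Injective (A.sectionToPointHom f) := fun k k' h => by
    rw [← A.ptSection_sectionToPointHom f k, h, ptSection_sectionToPointHom]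
  apply hinj
  rw [map_mul, sectionToPointHom_ptSection, sectionToPointHom_ptSection, sectionToPointHom_ptSection]

/-- `ptSection 1 = 1`. [cite: GortzWedhorn2020, Section (4.7), (4.7.1) (p. 108)] -/
theorem ptSection_one : A.ptSection f (1 : Over.mk f ⟶ A.X) = 1 := by
  have hinj : Function.Injective (A.sectionToPointHom f) := fun k k' h => by
    rw [← A.ptSection_sectionToPointHom f k, h, ptSection_sectionToPointHom]
  apply hinj
  rw [map_one, sectionToPointHom_ptSection]

/-- **`ptSection` as a group isomorphism `A(T∕S over f) ≃* A_T(T)`**. [cite: GortzWedhorn2020, Section (4.7), (4.7.1) (p. 108)] -/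
def ptSectionMulEquiv : (Over.mk f ⟶ A.X) ≃* (A.baseChange f).Sections where
  toFun := A.ptSection f
  invFun := A.sectionToPointHom f
  left_inv c := A.sectionToPointHom_ptSection f c
  right_inv k := A.ptSection_sectionToPointHom f k
  map_mul' := A.ptSection_mul f

/-- A torsion point gives a torsion section. [cite: MumfordFogartyKirwan1994, Ch. 7 §2 Definition 7.2 (p. 129)] -/
theorem ptSection_pow_eq_one {c : Over.mk f ⟶ A.X} (hc : c ^ M = 1) : A.ptSection f c ^ M = 1 := by
  change A.ptSectionMulEquiv f c ^ M = 1
  rw [← map_pow, hc, map_one]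
  
/-- **The `M`-torsion section of an `M`-torsion `T`-point.** [cite: MumfordFogartyKirwan1994, Ch. 7 §2 Definition 7.2 (p. 129)] -/
def ptTorsionSection (c : Over.mk f ⟶ A.X) (hc : c ^ M = 1) : (A.baseChange f).torsionSections M :=
  ⟨A.ptSection f c, A.ptSection_pow_eq_one M f hc⟩

/-- Unfolding. [cite: MumfordFogartyKirwan1994, Ch. 7 §2 Definition 7.2 (p. 129)] -/
@[simp] theorem coe_ptTorsionSection (c : Over.mk f ⟶ A.X) (hc : c ^ M = 1) :
    ((A.ptTorsionSection M f c hc : (A.baseChange f).torsionSections M) : (A.baseChange f).Sections) = A.ptSection f c := rfl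

end PtSection

/-! ## §2 Sections of points along a base change and along a homomorphism; transport of `weilUnit` along equal bases -/

section Along

open scoped CategoryTheory.Obj

variable {S : Scheme.{u}} (A : AbelianSchemeOver S) (M : ℕ) {T T' : Scheme.{u}} (f : T ⟶ S) (t : T' ⟶ T)

/-- `sectionAlong k ≫ pr_A = t ≫ k ≫ pr_A` on underlying schemes. [cite: GortzWedhorn2020, Section (4.7), (4.7.1) (p. 108)] -/
theorem sectionAlong_left_fst (k : (A.baseChange f).Sections) :
    (A.sectionAlong f t k).left ≫ pullback.fst A.X.hom (t ≫ f) = t ≫ k.left ≫ pullback.fst A.X.hom f := by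
  rw [sectionAlong_apply, Over.comp_left, Category.assoc, baseChangeCompGrpIso_inv_left_fst, ← Category.assoc]
  have h : ((A.baseChange f).sectionBaseChange t k).left ≫ pullback.fst (pullback.snd A.X.hom f) t = t ≫ k.left :=
    (A.baseChange f).sectionBaseChange_left_comp_fst t k
  rw [h, Category.assoc]

/-- **The section of a point along `t` is the section of the point along `t`**: `sectionAlong (ptSection c) = ptSection (t ≫ c)`.
[cite: GortzWedhorn2020, Section (4.7), (4.7.1) (p. 108)] -/
theorem sectionAlong_ptSection (c : Over.mk f ⟶ A.X) :
    A.sectionAlong f t (A.ptSection f c) = A.ptSection (t ≫ f) (pointAlong f t c) := by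
  apply Sections.ext_fst
  rw [sectionAlong_left_fst, ptSection_left_fst, ptSection_left_fst, pointAlong_left]

variable [IsCommMonObj (A.baseChange f).X] [IsCommMonObj (A.baseChange (t ≫ f)).X]

/-- The torsion-section form of `sectionAlong_ptSection`. [cite: MumfordFogartyKirwan1994, Ch. 7 §2 Definition 7.2 (p. 129)] -/
theorem torsionSectionAlong_ptTorsionSection (c : Over.mk f ⟶ A.X) (hc : c ^ M = 1) :
    A.torsionSectionAlong M f t (A.ptTorsionSection M f c hc) =
      A.ptTorsionSection M (t ≫ f) (pointAlong f t c) (pointAlong_pow_eq_one f t c hc) :=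
  Subtype.ext (A.sectionAlong_ptSection f t c)

end Along

section AlongHom

open scoped CategoryTheory.Obj

variable {S : Scheme.{u}} {A B : AbelianSchemeOver S} (φ : A.X ⟶ B.X) {T : Scheme.{u}} (f : T ⟶ S)

/-- **Sections of points are natural in homomorphisms**: `ptSection c ≫ φ_T = ptSection (c ≫ φ)`.
[cite: GortzWedhorn2020, Section (4.7), (4.7.1) (p. 108)] -/
theorem ptSection_comp_baseChangeHom (c : Over.mk f ⟶ A.X) :
    (A.ptSection f c : (A.baseChange f).Sections) ≫ baseChangeHom φ f = B.ptSection f (c ≫ φ) := by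
  apply Sections.ext_fst
  rw [Over.comp_left, Category.assoc, baseChangeHom_left_comp_fst, ptSection_left_fst_assoc, ptSection_left_fst,
    Over.comp_left]

end AlongHom

namespace DualPair

variable {S : Scheme.{u}} {A : AbelianSchemeOver S} [IsReduced S] [IsLocallyNoetherian S] (D : A.DualPair)
  (hD : Nonempty ((Scheme.Modules.pullback (DualPair.unitHatSlice D)).obj D.P ≅ SheafOfModules.unit _)) (n : ℕ)
  {T : Scheme.{u}}

/-- **`weilUnit` along EQUAL base morphisms** (`f = f′`): the Weil units agree as soon as the points of `Â` and the torsion sections have the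
same underlying morphisms (transport of the dependently-typed data `Over.mk f`, `A_f`; by `subst`).  The device by which the character family
is read over test schemes presented differently over `S` (`Spec θ ≫ Spec(k → T) = Spec(k → T′)` only propositionally).
[cite: MumfordAV1970, §20 (p. 184)] -/
theorem weilUnit_congr_base {f f' : T ⟶ S} (h : f = f') [IsLocallyNoetherian T] [IsCommMonObj (A.baseChange f).X]
    [IsCommMonObj (A.baseChange f').X] (c : Over.mk f ⟶ D.hat.X) (hc : c ^ n = 1) (c' : Over.mk f' ⟶ D.hat.X) (hc' : c' ^ n = 1)
    (hcc' : c.left = c'.left) (g : (A.baseChange f).torsionSections n) (g' : (A.baseChange f').torsionSections n)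
    (hgg' : (g : (A.baseChange f).Sections).left ≫ pullback.fst A.X.hom f = (g' : (A.baseChange f').Sections).left ≫ pullback.fst A.X.hom f') :
    D.weilUnit hD n f c hc g = D.weilUnit hD n f' c' hc' g' := by
  subst h
  obtain rfl : c = c' := Over.OverMorphism.ext hcc'
  obtain rfl : g = g' := Subtype.ext (Sections.ext_fst A f hgg')
  rfl

end DualPair

/-! ## §3 Over a field: the Weil character of finite torsion points -/

section Field

open scoped CategoryTheory.Obj

variable {k : Type u} [Field k]

/-- `Spec T` is locally Noetherian for a finite `k`-algebra `T` (finite over a field ⇒ Noetherian ring).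
[cite: GortzWedhorn2020, Section (4.7), (4.7.1) (p. 108)] -/
theorem isLocallyNoetherian_spec_of_finite (T : Type u) [CommRing T] [Algebra k T] [Module.Finite k T] :
    IsLocallyNoetherian (Spec (CommRingCat.of T)) := by
  haveI : IsNoetherianRing T := isNoetherian_of_tower k (inferInstance : IsNoetherian k T)
  infer_instance

/-- `A_T` is commutative for an abelian scheme `A` over a field (`A` is commutative over the reduced base `Spec k`, ★
`isCommMonObj_of_isReduced_base`, and the base-change functor is monoidal; cf. ★ `SerreTensorBaseChange.isCommMonObj_baseChange`).
[cite: MumfordFogartyKirwan1994, Ch. 6 §1 Corollary 6.5 (p. 117)] [cite: GortzWedhorn2020, Section (4.7) (pp. 107–108)] -/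
theorem isCommMonObj_baseChange_of_field {A : AbelianSchemeOver (Spec (CommRingCat.of k))}
    {T : Scheme.{u}} (f : T ⟶ Spec (CommRingCat.of k)) : IsCommMonObj (A.baseChange f).X :=
  haveI : IsCommMonObj A.X := A.isCommMonObj_of_isReduced_base
  inferInstanceAs (IsCommMonObj ((Over.pullback f).obj A.X))

variable {A : AbelianSchemeOver (Spec (CommRingCat.of k))} (D : A.DualPair)
  (hD : Nonempty ((Scheme.Modules.pullback (DualPair.unitHatSlice D)).obj D.P ≅ SheafOfModules.unit _)) (n : ℕ)

namespace DualPair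

open Classical in
/-- **THE WEIL CHARACTER `χ(ŷ, x) = e_n(x, ŷ) ∈ T` of `n`-torsion points `ŷ ∈ Â(T)`, `x ∈ A(T)` over a FINITE `k`-algebra `T`**: the Weil unit
(★ `weilUnit`) of the torsion section `(x, 1_T)` of `A_T` against the point `ŷ`, read in `T` through `Γ(Spec T, 𝒪) ≅ T` (Mathlib `Scheme.ΓSpecIso`).
The value `1` over non-finite `T` is a junk value (the laws below are over finite `T`, where `Spec T` is locally Noetherian).
[cite: MumfordAV1970, §20 (p. 184)] [cite: MilneAV2008, I §11] -/
def weilChar (hD : Nonempty ((Scheme.Modules.pullback (DualPair.unitHatSlice D)).obj D.P ≅ SheafOfModules.unit _)) (n : ℕ)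
    {T : Type u} [CommRing T] [Algebra k T] (y : specOver k T ⟶ D.hat.X) (hy : y ^ n = 1)
    (x : specOver k T ⟶ A.X) (hx : x ^ n = 1) : T :=
  if hT : Module.Finite k T then
    haveI := hT
    haveI : IsLocallyNoetherian (Spec (CommRingCat.of T)) := isLocallyNoetherian_spec_of_finite (k := k) T
    haveI : IsCommMonObj (A.baseChange (specOver k T).hom).X := isCommMonObj_baseChange_of_field _
    (Scheme.ΓSpecIso (CommRingCat.of T)).hom.hom
      (D.weilUnit hD n (specOver k T).hom y hy (A.ptTorsionSection n (specOver k T).hom x hx))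
  else 1

/-- Unfolding of `weilChar` over a finite `k`-algebra (any instances). [cite: MumfordAV1970, §20 (p. 184)] -/
theorem weilChar_eq {T : Type u} [CommRing T] [Algebra k T] [Module.Finite k T] [IsLocallyNoetherian (Spec (CommRingCat.of T))]
    [IsCommMonObj (A.baseChange (specOver k T).hom).X] (y : specOver k T ⟶ D.hat.X) (hy : y ^ n = 1)
    (x : specOver k T ⟶ A.X) (hx : x ^ n = 1) :
    D.weilChar hD n y hy x hx =
      (Scheme.ΓSpecIso (CommRingCat.of T)).hom.hom
        (D.weilUnit hD n (specOver k T).hom y hy (A.ptTorsionSection n (specOver k T).hom x hx)) := by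
  rw [weilChar, dif_pos ‹Module.Finite k T›]

/-- `weilChar` depends only on the points (congruence in `ŷ` and `x`; the torsion witnesses are propositions). [cite: MumfordAV1970, §20 (p. 184)] -/
theorem weilChar_congr {T : Type u} [CommRing T] [Algebra k T] {y₁ y₂ : specOver k T ⟶ D.hat.X} (hy : y₁ = y₂) (hy₁ : y₁ ^ n = 1)
    (hy₂ : y₂ ^ n = 1) {x₁ x₂ : specOver k T ⟶ A.X} (hx : x₁ = x₂) (hx₁ : x₁ ^ n = 1) (hx₂ : x₂ ^ n = 1) :
    D.weilChar hD n y₁ hy₁ x₁ hx₁ = D.weilChar hD n y₂ hy₂ x₂ hx₂ := by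
  subst hy hx
  rfl

variable {T T' : Type u} [CommRing T] [Algebra k T] [Module.Finite k T] [CommRing T'] [Algebra k T'] [Module.Finite k T']

/-- **`χ(ŷ, x₁ x₂) = χ(ŷ, x₁) χ(ŷ, x₂)`** (★ `weilUnit_mul`; `(x₁x₂, 1) = (x₁, 1)(x₂, 1)`). [cite: MumfordAV1970, §20 (p. 184)] -/
theorem weilChar_mul_right (y : specOver k T ⟶ D.hat.X) (hy : y ^ n = 1) (x₁ x₂ : specOver k T ⟶ A.X) (h₁ : x₁ ^ n = 1)
    (h₂ : x₂ ^ n = 1) (h₁₂ : (x₁ * x₂) ^ n = 1) :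
    D.weilChar hD n y hy (x₁ * x₂) h₁₂ = D.weilChar hD n y hy x₁ h₁ * D.weilChar hD n y hy x₂ h₂ := by
  haveI : IsLocallyNoetherian (Spec (CommRingCat.of T)) := isLocallyNoetherian_spec_of_finite (k := k) T
  haveI : IsLocallyNoetherian (specOver k T).left := ‹IsLocallyNoetherian (Spec (CommRingCat.of T))›
  haveI : IsCommMonObj (A.baseChange (specOver k T).hom).X := isCommMonObj_baseChange_of_field _
  have hm : A.ptTorsionSection n (specOver k T).hom (x₁ * x₂) h₁₂ =
      A.ptTorsionSection n (specOver k T).hom x₁ h₁ * A.ptTorsionSection n (specOver k T).hom x₂ h₂ :=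
    Subtype.ext (A.ptSection_mul (specOver k T).hom x₁ x₂)
  rw [weilChar_eq, weilChar_eq, weilChar_eq, hm, DualPair.weilUnit_mul, map_mul]

/-- **`χ(ŷ, 1) = 1`** (★ `weilUnit_one`). [cite: MumfordAV1970, §20 (p. 184)] -/
theorem weilChar_one_right (y : specOver k T ⟶ D.hat.X) (hy : y ^ n = 1) (h1 : (1 : specOver k T ⟶ A.X) ^ n = 1) :
    D.weilChar hD n y hy 1 h1 = 1 := by
  haveI : IsLocallyNoetherian (Spec (CommRingCat.of T)) := isLocallyNoetherian_spec_of_finite (k := k) T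
  haveI : IsLocallyNoetherian (specOver k T).left := ‹IsLocallyNoetherian (Spec (CommRingCat.of T))›
  haveI : IsCommMonObj (A.baseChange (specOver k T).hom).X := isCommMonObj_baseChange_of_field _
  have h : A.ptTorsionSection n (specOver k T).hom 1 h1 = 1 := Subtype.ext (A.ptSection_one (specOver k T).hom)
  rw [weilChar_eq, h, DualPair.weilUnit_one, map_one]

/-- **`χ(ŷ₁ ŷ₂, x) = χ(ŷ₁, x) χ(ŷ₂, x)`** (★ `weilUnit_mul_right`, which uses the unit hypothesis `hD`). [cite: MumfordAV1970, §20 (p. 184)] -/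
theorem weilChar_mul_left (y₁ y₂ : specOver k T ⟶ D.hat.X) (h₁ : y₁ ^ n = 1) (h₂ : y₂ ^ n = 1) (h₁₂ : (y₁ * y₂) ^ n = 1)
    (x : specOver k T ⟶ A.X) (hx : x ^ n = 1) :
    D.weilChar hD n (y₁ * y₂) h₁₂ x hx = D.weilChar hD n y₁ h₁ x hx * D.weilChar hD n y₂ h₂ x hx := by
  haveI : IsLocallyNoetherian (Spec (CommRingCat.of T)) := isLocallyNoetherian_spec_of_finite (k := k) T
  haveI : IsLocallyNoetherian (specOver k T).left := ‹IsLocallyNoetherian (Spec (CommRingCat.of T))›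
  haveI : IsCommMonObj (A.baseChange (specOver k T).hom).X := isCommMonObj_baseChange_of_field _
  rw [weilChar_eq, weilChar_eq, weilChar_eq, DualPair.weilUnit_mul_right D hD n (specOver k T).hom y₁ y₂ h₁ h₂ h₁₂, map_mul]

/-- **NATURALITY IN THE TEST RING: `χ(Spec θ ≫ ŷ, Spec θ ≫ x) = θ(χ(ŷ, x))`** for a `k`-algebra map `θ : T → T′` of finite `k`-algebras (★
`weilUnit_baseChange` along `Spec θ`, the sections of points along `Spec θ` (§2), transport along `Spec θ ≫ Spec(k → T) = Spec(k → T′)`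
(`weilUnit_congr_base`), and `Γ(Spec θ) = θ` under `ΓSpecIso` (Mathlib `Scheme.ΓSpecIso_naturality`)). [cite: MumfordAV1970, §20 (pp. 184–185)] -/
theorem weilChar_naturality (θ : T →ₐ[k] T') (y : specOver k T ⟶ D.hat.X) (hy : y ^ n = 1) (x : specOver k T ⟶ A.X)
    (hx : x ^ n = 1) (hy' : (AlgPoints.specOverMapOfAlgHom θ ≫ y) ^ n = 1) (hx' : (AlgPoints.specOverMapOfAlgHom θ ≫ x) ^ n = 1) :
    D.weilChar hD n (AlgPoints.specOverMapOfAlgHom θ ≫ y) hy' (AlgPoints.specOverMapOfAlgHom θ ≫ x) hx' =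
      θ (D.weilChar hD n y hy x hx) := by
  haveI : IsLocallyNoetherian (Spec (CommRingCat.of T)) := isLocallyNoetherian_spec_of_finite (k := k) T
  haveI : IsLocallyNoetherian (Spec (CommRingCat.of T')) := isLocallyNoetherian_spec_of_finite (k := k) T'
  haveI : IsLocallyNoetherian (specOver k T).left := ‹IsLocallyNoetherian (Spec (CommRingCat.of T))›
  haveI : IsLocallyNoetherian (specOver k T').left := ‹IsLocallyNoetherian (Spec (CommRingCat.of T'))›
  haveI : IsCommMonObj (A.baseChange (specOver k T).hom).X := isCommMonObj_baseChange_of_field _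
  haveI : IsCommMonObj (A.baseChange (specOver k T').hom).X := isCommMonObj_baseChange_of_field _
  -- `Spec θ` as a morphism of test schemes over `Spec T`
  let t : (specOver k T').left ⟶ (specOver k T).left := (AlgPoints.specOverMapOfAlgHom θ).left
  haveI : IsCommMonObj (A.baseChange (t ≫ (specOver k T).hom)).X := isCommMonObj_baseChange_of_field _
  have hbase : t ≫ (specOver k T).hom = (specOver k T').hom := Over.w (AlgPoints.specOverMapOfAlgHom θ)
  -- base change of the Weil unit along `Spec θ`, then transport to the base `Spec(k → T′)`
  have hbc := D.weilUnit_baseChange hD n (specOver k T).hom y hy t (A.ptTorsionSection n (specOver k T).hom x hx)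
  rw [A.torsionSectionAlong_ptTorsionSection n (specOver k T).hom t x hx] at hbc
  have htr := D.weilUnit_congr_base hD n hbase (pointAlong (specOver k T).hom t y)
    (pointAlong_pow_eq_one (specOver k T).hom t y hy) (AlgPoints.specOverMapOfAlgHom θ ≫ y) hy' rfl
    (A.ptTorsionSection n (t ≫ (specOver k T).hom) (pointAlong (specOver k T).hom t x)
      (pointAlong_pow_eq_one (specOver k T).hom t x hx))
    (A.ptTorsionSection n (specOver k T').hom (AlgPoints.specOverMapOfAlgHom θ ≫ x) hx')
    (by rw [coe_ptTorsionSection, coe_ptTorsionSection, ptSection_left_fst, ptSection_left_fst]; rfl)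
  rw [weilChar_eq, weilChar_eq, ← htr, hbc]
  -- `Γ(Spec θ) = θ` under `ΓSpecIso`
  have hΓ := DFunLike.congr_fun (CommRingCat.hom_ext_iff.mp (Scheme.ΓSpecIso_naturality (CommRingCat.ofHom θ.toRingHom)))
    (D.weilUnit hD n (specOver k T).hom y hy (A.ptTorsionSection n (specOver k T).hom x hx))
  simp only [CommRingCat.hom_comp, CommRingCat.hom_ofHom] at hΓ
  exact hΓ

end DualPair

end Field

end Literature.AlgebraicGeometry.AbelianSchemes.AbelianSchemeOver

end
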